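import Summits.Ventures.LatticeQCDFlow.Scoring.GaussVandermondeSecondMoment
import HarnessLib

/-!
# The fourth moment of the Gaussian–Vandermonde law: `∫ |φ|⁴ e^{−|φ|²/2} Π_{j≺k}(φ_j − φ_k)² dφ = N²(N²+2) · M_N` (the GUE identity `E (tr H²)² = N²(N² + 2)`), by scaling

HONEST FRAMING: exact (Metropolis-corrected) sampling algorithms for lattice gauge theory;
figures of merit are autocorrelation/cost numbers at stated couplings and volumes; no
continuum-physics claim.

Venture `LatticeQCDFlow` (cell pub-lqcd), sub-topic `Scoring`; FANOUT row 5 (`s0-sun-a`), GEN-20.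
NEW WORK of the cell (placement rule).  Input of the weak-coupling law of the PLAQUETTE VARIANCE of `U(N)` (the 2-d
"specific heat" `β² Var_β(Re tr U_p) → N²/2`, sibling file `PlaquetteVarianceWeakCoupling`).  With
`M_N = ∫ e^{−Σφ²/2} Π_{j≺k}(φ_j − φ_k)²` (GEN-20 `BesselToeplitzLaplace`), GEN-20 `GaussVandermondeSecondMoment` gave the second
moment `∫ (Σφ²) e^{−Σφ²/2}Δ² = N² M_N` by differentiating the scaling law once.  Here, by the same device applied to the
FIRST-MOMENT scaling law:

* `sq_sum_sq_le_prod_sq` (`(Σφ_b²)² ≤ (Π(1+φ_b²))²`);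
* **`integral_normSq_gaussVandermonde_scale`** — `∫ (Σφ²) e^{−tΣφ²/2} Δ² = N² M_N / √t^{N²+2}` (`t > 0`, by `φ ↦ √t φ`);
* **`integral_normSq_sq_gaussVandermonde`** — `∫ (Σφ²)² e^{−Σφ²/2} Δ² = N²(N²+2) · M_N` (differentiation under the integral
  sign at `t = 1`): under the normalised law `Σφ²/2` has mean `N²/2` and variance `N²/2` (`N² = dim U(N)`).

The `SU(N)` twin (hyperplane `Σφ = 0`, `(N²−1)(N²+1) · M^{SU}_N`) is `SpecialUnitaryGaussFourthMoment`.
No `def`, nothing cited as a fact, 0 sorry.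
-/

noncomputable section

open Real MeasureTheory Filter Topology Finset
open Literature.RepresentationTheory.CompactGroups.WeylIntegration (OD enum)

namespace Summit.Ventures.LatticeQCDFlow.Scoring

section GUE4

variable {n : Type*} [Fintype n]

/-- `(Σ_b φ_b²)² ≤ (Π_b (1 + φ_b²))²`. -/
theorem sq_sum_sq_le_prod_sq (φ : n → ℝ) : (∑ b, φ b ^ 2) ^ 2 ≤ (∏ b, (1 + φ b ^ 2)) ^ 2 :=
  pow_le_pow_left₀ (Finset.sum_nonneg fun b _ => sq_nonneg (φ b)) (sum_sq_le_prod_one_add_sq φ) 2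

variable [DecidableEq n]

/-- **First-moment scaling law**: `∫ (Σφ_b²) e^{−tΣφ_b²/2} Π_{j≺k}(φ_j − φ_k)² dφ = N² · M_N / √t^{N²+2}` for `t > 0`. -/
theorem integral_normSq_gaussVandermonde_scale {t : ℝ} (ht : 0 < t) :
    ∫ φ : n → ℝ, (∑ b, φ b ^ 2) * (Real.exp (∑ b, -(t * φ b ^ 2 / 2)) * ∏ p : OD n, (φ p.1.1 - φ p.1.2) ^ 2)
      = (Fintype.card n : ℝ) ^ 2 *
          (∫ φ : n → ℝ, Real.exp (∑ b, -(φ b ^ 2 / 2)) * ∏ p : OD n, (φ p.1.1 - φ p.1.2) ^ 2) /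
          √t ^ (Fintype.card n ^ 2 + 2) := by
  have hs : 0 < √t := Real.sqrt_pos.2 ht
  set M : ℝ := ∫ φ : n → ℝ, Real.exp (∑ b, -(φ b ^ 2 / 2)) * ∏ p : OD n, (φ p.1.1 - φ p.1.2) ^ 2 with hM
  set G : (n → ℝ) → ℝ := fun φ => (∑ b, φ b ^ 2) *
    (Real.exp (∑ b, -(φ b ^ 2 / 2)) * ∏ p : OD n, (φ p.1.1 - φ p.1.2) ^ 2) with hG
  have hGint : ∫ φ, G φ = (Fintype.card n : ℝ) ^ 2 * M := integral_normSq_gaussVandermonde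
  -- `G(√t • φ) = t √t^{2|OD|} · (scaled integrand)`
  have hpt : ∀ φ : n → ℝ, G (√t • φ)
      = t * √t ^ (2 * Fintype.card (OD n)) * ((∑ b, φ b ^ 2) *
          (Real.exp (∑ b, -(t * φ b ^ 2 / 2)) * ∏ p : OD n, (φ p.1.1 - φ p.1.2) ^ 2)) := by
    intro φ
    simp only [hG, Pi.smul_apply, smul_eq_mul]
    have h0 : ∑ b, (√t * φ b) ^ 2 = t * ∑ b, φ b ^ 2 := by
      rw [Finset.mul_sum]
      refine Finset.sum_congr rfl fun b _ => ?_
      rw [mul_pow, Real.sq_sqrt ht.le]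
    have h1 : ∑ b, -((√t * φ b) ^ 2 / 2) = ∑ b, -(t * φ b ^ 2 / 2) := by
      refine Finset.sum_congr rfl fun b _ => ?_
      rw [mul_pow, Real.sq_sqrt ht.le]
    have h2 : ∏ p : OD n, (√t * φ p.1.1 - √t * φ p.1.2) ^ 2 = √t ^ (2 * Fintype.card (OD n)) *
        ∏ p : OD n, (φ p.1.1 - φ p.1.2) ^ 2 := by
      have hc : ∏ _p : OD n, √t ^ 2 = √t ^ (2 * Fintype.card (OD n)) := by
        rw [Finset.prod_const, Finset.card_univ, ← pow_mul, mul_comm]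
      rw [← hc, ← Finset.prod_mul_distrib]
      exact Finset.prod_congr rfl fun p _ => by ring
    rw [h0, h1, h2]
    ring
  have hcomp := Measure.integral_comp_smul volume G (√t)
  rw [Module.finrank_fintype_fun_eq_card, smul_eq_mul] at hcomp
  simp_rw [hpt] at hcomp
  rw [integral_const_mul, hGint] at hcomp
  have hcard : Fintype.card n ^ 2 = Fintype.card n + 2 * Fintype.card (OD n) := (card_add_two_mul_card_OD (n := n)).symm
  have habs : |(√t ^ Fintype.card n)⁻¹| = (√t ^ Fintype.card n)⁻¹ := abs_of_pos (by positivity)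
  rw [habs] at hcomp
  have ht2 : √t ^ 2 = t := Real.sq_sqrt ht.le
  rw [hcard, pow_add, pow_add, ht2, eq_div_iff (by positivity)]
  calc (∫ φ : n → ℝ, (∑ b, φ b ^ 2) * (Real.exp (∑ b, -(t * φ b ^ 2 / 2)) * ∏ p : OD n, (φ p.1.1 - φ p.1.2) ^ 2)) *
        (√t ^ Fintype.card n * √t ^ (2 * Fintype.card (OD n)) * t)
      = (t * √t ^ (2 * Fintype.card (OD n)) * ∫ φ : n → ℝ, (∑ b, φ b ^ 2) *
          (Real.exp (∑ b, -(t * φ b ^ 2 / 2)) * ∏ p : OD n, (φ p.1.1 - φ p.1.2) ^ 2)) * √t ^ Fintype.card n := by ring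
    _ = (√t ^ Fintype.card n)⁻¹ * ((Fintype.card n : ℝ) ^ 2 * M) * √t ^ Fintype.card n := by rw [hcomp]
    _ = (Fintype.card n : ℝ) ^ 2 * M := by field_simp

/-- **`∫ (Σ_b φ_b²)² e^{−Σφ²/2} Π_{j≺k}(φ_j − φ_k)² dφ = N²(N² + 2) · M_N`** (the GUE identity `E (tr H²)² = N²(N²+2)`):
differentiate the first-moment scaling law at `t = 1` under the integral sign. -/
theorem integral_normSq_sq_gaussVandermonde :
    ∫ φ : n → ℝ, (∑ b, φ b ^ 2) ^ 2 * (Real.exp (∑ b, -(φ b ^ 2 / 2)) * ∏ p : OD n, (φ p.1.1 - φ p.1.2) ^ 2)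
      = (Fintype.card n : ℝ) ^ 2 * ((Fintype.card n : ℝ) ^ 2 + 2) *
        ∫ φ : n → ℝ, Real.exp (∑ b, -(φ b ^ 2 / 2)) * ∏ p : OD n, (φ p.1.1 - φ p.1.2) ^ 2 := by
  set M : ℝ := ∫ φ : n → ℝ, Real.exp (∑ b, -(φ b ^ 2 / 2)) * ∏ p : OD n, (φ p.1.1 - φ p.1.2) ^ 2 with hM
  -- the family `F t φ = (Σφ²) e^{−tΣφ²/2} Δ²` and its `t`-derivative
  set F : ℝ → (n → ℝ) → ℝ := fun t φ => (∑ b, φ b ^ 2) *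
    (Real.exp (∑ b, -(t * φ b ^ 2 / 2)) * ∏ p : OD n, (φ p.1.1 - φ p.1.2) ^ 2) with hF
  set F' : ℝ → (n → ℝ) → ℝ := fun t φ => -((∑ b, φ b ^ 2) / 2) * ((∑ b, φ b ^ 2) *
    (Real.exp (∑ b, -(t * φ b ^ 2 / 2)) * ∏ p : OD n, (φ p.1.1 - φ p.1.2) ^ 2)) with hF'
  have hcont : ∀ t, Continuous (F t) := fun t => by simp only [hF]; fun_prop
  have hcont' : ∀ t, Continuous (F' t) := fun t => by simp only [hF']; fun_prop
  -- pointwise derivative in `t`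
  have hderiv : ∀ φ : n → ℝ, ∀ t : ℝ, HasDerivAt (fun s => F s φ) (F' t φ) t := by
    intro φ t
    simp only [hF, hF']
    have h1 : HasDerivAt (fun s : ℝ => ∑ b, -(s * φ b ^ 2 / 2)) (-((∑ b, φ b ^ 2) / 2)) t := by
      have : (fun s : ℝ => ∑ b, -(s * φ b ^ 2 / 2)) = fun s => s * (-((∑ b, φ b ^ 2) / 2)) := by
        funext s
        rw [mul_neg, Finset.sum_div, Finset.mul_sum, ← Finset.sum_neg_distrib]
        exact Finset.sum_congr rfl fun b _ => by ring
      rw [this]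
      simpa using (hasDerivAt_id t).mul_const (-((∑ b, φ b ^ 2) / 2))
    have h2 := (h1.exp.mul_const (∏ p : OD n, (φ p.1.1 - φ p.1.2) ^ 2)).const_mul (∑ b, φ b ^ 2)
    refine h2.congr_deriv ?_
    ring
  -- domination on `t ∈ (1/2, 3/2)`
  have hbound : ∀ φ : n → ℝ, ∀ t ∈ Set.Ioo (1 / 2 : ℝ) (3 / 2), ‖F' t φ‖
      ≤ 2 ^ Fintype.card (OD n) * ∏ b, (Real.exp (-(2 / π ^ 2 * φ b ^ 2)) * (1 + φ b ^ 2) ^ (Fintype.card (OD n) + 2)) := by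
    intro φ t ht
    simp only [hF', Real.norm_eq_abs]
    have hS0 : 0 ≤ ∑ b, φ b ^ 2 := Finset.sum_nonneg fun b _ => sq_nonneg _
    have hR0 : 0 ≤ Real.exp (∑ b, -(t * φ b ^ 2 / 2)) * ∏ p : OD n, (φ p.1.1 - φ p.1.2) ^ 2 :=
      mul_nonneg (Real.exp_nonneg _) (Finset.prod_nonneg fun p _ => sq_nonneg _)
    rw [show -((∑ b, φ b ^ 2) / 2) * ((∑ b, φ b ^ 2) * (Real.exp (∑ b, -(t * φ b ^ 2 / 2)) *
        ∏ p : OD n, (φ p.1.1 - φ p.1.2) ^ 2)) = -(((∑ b, φ b ^ 2) ^ 2 / 2) * (Real.exp (∑ b, -(t * φ b ^ 2 / 2)) *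
        ∏ p : OD n, (φ p.1.1 - φ p.1.2) ^ 2)) by ring, abs_neg, abs_of_nonneg (mul_nonneg (by positivity) hR0)]
    have hexp : Real.exp (∑ b, -(t * φ b ^ 2 / 2)) ≤ ∏ b, Real.exp (-(2 / π ^ 2 * φ b ^ 2)) := by
      rw [← Real.exp_sum]
      refine Real.exp_le_exp.2 (Finset.sum_le_sum fun b _ => ?_)
      have hπ : 2 / π ^ 2 ≤ 1 / 4 := by
        rw [div_le_div_iff₀ (by positivity) (by norm_num)]
        nlinarith [Real.pi_gt_three]
      nlinarith [sq_nonneg (φ b), ht.1]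
    have hmain := mul_prod_le_laplaceBound φ hexp (fun p => sq_nonneg _) (fun p => le_rfl)
    have hsum : (∑ b, φ b ^ 2) ^ 2 / 2 ≤ (∏ b, (1 + φ b ^ 2)) ^ 2 := by
      have := sq_sum_sq_le_prod_sq φ
      have h0 : 0 ≤ (∑ b, φ b ^ 2) ^ 2 := sq_nonneg _
      linarith
    calc (∑ b, φ b ^ 2) ^ 2 / 2 * (Real.exp (∑ b, -(t * φ b ^ 2 / 2)) * ∏ p : OD n, (φ p.1.1 - φ p.1.2) ^ 2)
        ≤ (∏ b, (1 + φ b ^ 2)) ^ 2 * (2 ^ Fintype.card (OD n) *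
          ∏ b, (Real.exp (-(2 / π ^ 2 * φ b ^ 2)) * (1 + φ b ^ 2) ^ Fintype.card (OD n))) :=
          mul_le_mul hsum hmain hR0 (by positivity)
      _ = 2 ^ Fintype.card (OD n) * ∏ b, (Real.exp (-(2 / π ^ 2 * φ b ^ 2)) * (1 + φ b ^ 2) ^ (Fintype.card (OD n) + 2)) := by
          rw [mul_left_comm, ← Finset.prod_pow, ← Finset.prod_mul_distrib]
          congr 1
          exact Finset.prod_congr rfl fun b _ => by ring
  have hint1 : Integrable (F 1) := by
    refine Integrable.mono' (integrable_gaussPolyBound (2 ^ Fintype.card (OD n)) (Fintype.card (OD n) + 1))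
      (hcont 1).aestronglyMeasurable (Eventually.of_forall fun φ => ?_)
    have hS0 : 0 ≤ ∑ b, φ b ^ 2 := Finset.sum_nonneg fun b _ => sq_nonneg _
    have hR0 : 0 ≤ Real.exp (∑ b, -(1 * φ b ^ 2 / 2)) * ∏ p : OD n, (φ p.1.1 - φ p.1.2) ^ 2 :=
      mul_nonneg (Real.exp_nonneg _) (Finset.prod_nonneg fun p _ => sq_nonneg _)
    rw [Real.norm_eq_abs, abs_of_nonneg (mul_nonneg hS0 hR0)]
    have hexp : Real.exp (∑ b, -(1 * φ b ^ 2 / 2)) ≤ ∏ b, Real.exp (-(2 / π ^ 2 * φ b ^ 2)) := by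
      rw [← Real.exp_sum]
      refine Real.exp_le_exp.2 (Finset.sum_le_sum fun b _ => ?_)
      have hπ : 2 / π ^ 2 ≤ 1 / 2 := by
        rw [div_le_div_iff₀ (by positivity) (by norm_num)]
        nlinarith [Real.pi_gt_three]
      nlinarith [sq_nonneg (φ b)]
    have hmain := mul_prod_le_laplaceBound φ hexp (fun p => sq_nonneg _) (fun p => le_rfl)
    calc (∑ b, φ b ^ 2) * (Real.exp (∑ b, -(1 * φ b ^ 2 / 2)) * ∏ p : OD n, (φ p.1.1 - φ p.1.2) ^ 2)
        ≤ (∏ b, (1 + φ b ^ 2)) * (2 ^ Fintype.card (OD n) *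
          ∏ b, (Real.exp (-(2 / π ^ 2 * φ b ^ 2)) * (1 + φ b ^ 2) ^ Fintype.card (OD n))) :=
          mul_le_mul (sum_sq_le_prod_one_add_sq φ) hmain hR0 (Finset.prod_nonneg fun b _ => by positivity)
      _ = 2 ^ Fintype.card (OD n) * ∏ b, (Real.exp (-(2 / π ^ 2 * φ b ^ 2)) * (1 + φ b ^ 2) ^ (Fintype.card (OD n) + 1)) := by
          rw [mul_left_comm, ← Finset.prod_mul_distrib]
          congr 1
          exact Finset.prod_congr rfl fun b _ => by ring
  have hD := hasDerivAt_integral_of_dominated_loc_of_deriv_le (μ := (volume : Measure (n → ℝ))) (x₀ := (1 : ℝ))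
    (F := F) (F' := F') (s := Set.Ioo (1 / 2 : ℝ) (3 / 2)) (Ioo_mem_nhds (by norm_num) (by norm_num))
    (Eventually.of_forall fun t => (hcont t).aestronglyMeasurable) hint1 (hcont' 1).aestronglyMeasurable
    (Eventually.of_forall fun φ t ht => hbound φ t ht) (integrable_gaussPolyBound _ _)
    (Eventually.of_forall fun φ t _ => hderiv φ t)
  -- the same derivative from the scaling law: `d/dt (N² M t^{−(N²+2)/2}) = −N²(N²+2)/2 · M` at `t = 1`
  have hscale : ∀ᶠ t : ℝ in 𝓝 1, ∫ φ, F t φ =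
      (Fintype.card n : ℝ) ^ 2 * M * (t ^ (-(((Fintype.card n : ℝ) ^ 2 + 2) / 2))) := by
    filter_upwards [Ioo_mem_nhds (show (1 / 2 : ℝ) < 1 by norm_num) (show (1 : ℝ) < 3 / 2 by norm_num)] with t ht
    have ht0 : 0 < t := by linarith [ht.1]
    show (∫ φ : n → ℝ, (∑ b, φ b ^ 2) * (Real.exp (∑ b, -(t * φ b ^ 2 / 2)) *
      ∏ p : OD n, (φ p.1.1 - φ p.1.2) ^ 2)) = _
    have hpow : √t ^ (Fintype.card n ^ 2 + 2) = t ^ (((Fintype.card n : ℝ) ^ 2 + 2) / 2) := by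
      rw [Real.sqrt_eq_rpow, ← Real.rpow_natCast, ← Real.rpow_mul ht0.le]
      congr 1
      push_cast
      ring
    rw [integral_normSq_gaussVandermonde_scale ht0, hM.symm, hpow, Real.rpow_neg ht0.le, div_eq_mul_inv]
  have hD2 : HasDerivAt (fun t : ℝ => ∫ φ, F t φ)
      ((Fintype.card n : ℝ) ^ 2 * M * (-(((Fintype.card n : ℝ) ^ 2 + 2) / 2))) 1 := by
    have h := (Real.hasDerivAt_rpow_const (x := (1 : ℝ)) (p := -(((Fintype.card n : ℝ) ^ 2 + 2) / 2))
      (Or.inl one_ne_zero)).const_mul ((Fintype.card n : ℝ) ^ 2 * M)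
    simp only [Real.one_rpow, mul_one] at h
    exact h.congr_of_eventuallyEq hscale
  have huniq := hD.2.unique hD2
  -- `∫ F' 1 = −(1/2) ∫ (Σφ²)² e^{−Σφ²/2} Δ²`
  have hF'1 : ∫ φ, F' 1 φ = -(1 / 2) * ∫ φ : n → ℝ, (∑ b, φ b ^ 2) ^ 2 *
      (Real.exp (∑ b, -(φ b ^ 2 / 2)) * ∏ p : OD n, (φ p.1.1 - φ p.1.2) ^ 2) := by
    rw [← integral_const_mul]
    refine integral_congr_ae (Eventually.of_forall fun φ => ?_)
    simp only [hF', one_mul]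
    ring
  rw [hF'1] at huniq
  have : ∫ φ : n → ℝ, (∑ b, φ b ^ 2) ^ 2 * (Real.exp (∑ b, -(φ b ^ 2 / 2)) * ∏ p : OD n, (φ p.1.1 - φ p.1.2) ^ 2)
      = (Fintype.card n : ℝ) ^ 2 * ((Fintype.card n : ℝ) ^ 2 + 2) * M := by linarith
  rw [this]

end GUE4


end Summit.Ventures.LatticeQCDFlow.Scoring
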